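import Summits.SmoothPoincare4.SmoothPoincare4.Theses.ZeroSurgeryExotic
import Literature.Uncategorized.Crux
import Literature.Topology.FourManifolds.Rasmussen
import Literature.Topology.FourManifolds.HomotopyBallSliceProofs
import Literature.Topology.FourManifolds.SliceRibbon

/-!
# Sketch (crux-ideate r1, ideator 3 / gen 2) — first lemmas of the line `satellite-descent-refill`

Crux `ZseCruxRasmussen` (item stmt-SmoothPoincare4-0366) = `Literature.Uncategorized.Crux` verbatim.

The line: (DESCENT) a winding-number-one satellite operator `P` with strong winding number `±1` and
`P(U)` ribbon (Cochran–Davis–Ray 2014, Def. 1.1 / Cor. 4.5; Cochran–Ray 2016, Cor. 3.9) has the property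
that `P(K')` smoothly slice ⇒ `K'` slice in an EXPLICIT homotopy 4-ball
`B_P(K') = (B⁴ ∖ νΔ_{P(K')}) ∪_N (B⁴ ∖ νΔ_{P(U)}) ∪ 2h(μ_{K'})`; with `s(K') ≠ 0` this already decides the
route's waypoint `ZseHsliceNotSlice` (item 0520) and hence `¬ SmoothPoincare4`; (REFILL) a Kirby-calculus
certificate that `B_P(K') ∖ ν(cocore)` is a genuine slice-disc exterior `B⁴ ∖ νD_K` hands over a smoothly
slice `K` with `S³₀(K) ≅ S³₀(K')`, i.e. the crux verbatim.

Only the logical skeleton is typed here (the tree has no satellite / pattern API): the descent property is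
an INTERFACE on an operator `P : Knot → Knot`; its CONSTRUCTION (CDR Cor. 4.5 for Mazur-type patterns) is a
separate statement, never smuggled into the interface.
-/

noncomputable section

open scoped Manifold ContDiff
open Literature.Topology.FourManifolds Literature.Barriers.SmoothPoincare4 Literature.Uncategorized

set_option linter.dupNamespace false

namespace Summit.SmoothPoincare4.SmoothPoincare4.Cruxes.ZseCruxRasmussen.Ideator3g2

/-- Local notation: `𝔼 n` is `EuclideanSpace ℝ (Fin n)`. -/
local notation "𝔼 " n:arg => EuclideanSpace ℝ (Fin n)

/-- INTERFACE. A **descent operator** is a map of knots `P` such that smooth sliceness of `P K` forces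
`K` to be slice in a homotopy 4-ball. Cochran–Davis–Ray 2014, Cor. 4.5: every satellite operator of strong
winding number `±1` whose pattern knot `P(U)` is (pseudo-)slice is one ("weakly injective on `𝒞^{ex}`").
Cochran–Ray 2016, Cor. 3.9: `K` is `0`-shake slice iff `P(K)` is slice for SOME winding-number-one `P`
with `P(U)` ribbon. -/
def IsDescentOperator (P : Knot → Knot) : Prop :=
  ∀ K : Knot, (P K).IsSmoothlySlice → K.IsHomotopyBallSlice

/-- CONSTRUCTION statement (the line's stub `stub_cdr`, kept separate from the interface): some descent
operator exists whose pattern knot is ribbon — in print, every unknotted winding-number-one pattern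
(Cochran–Davis–Ray 2014, Prop. 2.1 + Cor. 4.5), e.g. the Mazur pattern and its mirror. -/
def ExistsRibbonDescentOperator : Prop :=
  ∃ P : Knot → Knot, IsDescentOperator P ∧ (P unknot).IsRibbon

/-- DESCENT DATA: a descent operator `P`, an input knot `K'` with a non-zero Rasmussen invariant, and a
ribbon certificate for the satellite `P K'`. -/
def DescentData : Prop :=
  ∃ (P : Knot → Knot) (K' : Knot) (s : ℤ),
    IsDescentOperator P ∧ (P K').IsRibbon ∧ K'.HasRasmussenInvariant s ∧ s ≠ 0

/-- REFILL DATUM for `K'` (3-manifold shadow of "the homotopy-ball disc exterior of `K'` is a genuine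
slice-disc exterior"): a smoothly slice knot with the same `0`-surgery as `K'`. -/
def RefillData (K' : Knot) : Prop :=
  ∃ (K : Knot) (Y : Type) (_ : TopologicalSpace Y) (_ : ChartedSpace (𝔼 3) Y),
    IsIntegralSurgery (𝓡 3) Y K 0 ∧ IsIntegralSurgery (𝓡 3) Y K' 0 ∧ K.IsSmoothlySlice

/-- The transfer statement `C⁺` of the card: descent data whose input knot admits a refill. -/
def DescentRefill : Prop :=
  ∃ (P : Knot → Knot) (K' : Knot) (s : ℤ),
    IsDescentOperator P ∧ (P K').IsRibbon ∧ K'.HasRasmussenInvariant s ∧ s ≠ 0 ∧ RefillData K'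

/-! ## First lemmas -/

/-- FIRST LEMMA (a). Descent data give the FGMW configuration (registered open statement
`FGMWRasmussenStrategy`) — no 0-surgery homeomorphism is needed for this. -/
theorem fgmwRasmussenStrategy_of_descent (h : DescentData) : FGMWRasmussenStrategy := by
  obtain ⟨P, K', s, hP, hrib, hs, hs0⟩ := h
  exact ⟨K', hP K' hrib.isSmoothlySlice, s, hs, hs0⟩

/-- FIRST LEMMA (b). Descent data decide the route's waypoint `ZseHsliceNotSlice` (item 0520), mod
Rasmussen's Theorem 1 (tree named fact `eq_zero_of_isSmoothlySlice`). -/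
theorem zseHsliceNotSlice_of_descent (hR : eq_zero_of_isSmoothlySlice) (h : DescentData) :
    Theses.ZeroSurgeryExotic.ZseHsliceNotSlice := by
  obtain ⟨P, K', s, hP, hrib, hs, hs0⟩ := h
  exact ⟨K', hP K' hrib.isSmoothlySlice, fun hsl => hs0 (hR hs hsl)⟩

/-- FIRST LEMMA (c). Hence descent data already refute `SmoothPoincare4` through the tree's PROVED FGMW
lemma — the route is decided even before the refill lands the crux. -/
theorem not_spc4_of_descent (hR : eq_zero_of_isSmoothlySlice) (h : DescentData) :
    ¬ _root_.SmoothPoincare4 := by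
  intro hS
  obtain ⟨M, i₁, i₂, i₃, i₄, i₅, i₆, ⟨e⟩, hE⟩ :=
    Knot.exists_exotic_of_isHomotopyBallSlice_not_isSmoothlySlice_holds
      (zseHsliceNotSlice_of_descent hR h)
  obtain ⟨d⟩ := hS M i₄ i₅ e
  exact hE.false d

/-- FIRST LEMMA (d). The transfer `C⁺ ⇒ Crux`: descent data plus a refill give the crux VERBATIM. -/
theorem crux_of_descentRefill (h : DescentRefill) : Crux := by
  obtain ⟨P, K', s, -, -, hs, hs0, K, Y, _, _, hK, hK', hsl⟩ := h
  exact ⟨K, K', Y, _, _, s, hK, hK', hsl, hs, hs0⟩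

/-- Sanity: the crux itself is descent-free refill data with an `s`-witness (so `RefillData` is exactly the
residual datum the crux asks for beyond FGMW). -/
theorem crux_iff_exists_refill :
    Crux ↔ ∃ (K' : Knot) (s : ℤ), K'.HasRasmussenInvariant s ∧ s ≠ 0 ∧ RefillData K' := by
  constructor
  · rintro ⟨K, K', Y, _, _, s, hK, hK', hsl, hs, hs0⟩
    exact ⟨K', s, hs, hs0, K, Y, _, _, hK, hK', hsl⟩
  · rintro ⟨K', s, hs, hs0, K, Y, _, _, hK, hK', hsl⟩
    exact ⟨K, K', Y, _, _, s, hK, hK', hsl, hs, hs0⟩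

/-- The disprover's kill switch read on this line: `SVanishesOnPairs` (item 0368) forbids refills of any
descent witness — a descent witness `K'` (HB-slice, `s ≠ 0`) whose ball refills would contradict it. So
under 0368 every descent ball `B_P(K')` with `s(K') ≠ 0` is a NON-refillable exotic ball. -/
theorem not_refill_of_sVanishesOnPairs (hV : SVanishesOnPairs) {K' : Knot} {s : ℤ}
    (hs : K'.HasRasmussenInvariant s) (hs0 : s ≠ 0) : ¬ RefillData K' := by
  rintro ⟨K, Y, _, _, hK, hK', hsl⟩
  exact hs0 (hV K K' Y s hK hK' hsl hs)

end Summit.SmoothPoincare4.SmoothPoincare4.Cruxes.ZseCruxRasmussen.Ideator3g2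

end
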